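import Summits.QuantumFields.YangMills.Theorems.BalabanUVNodesN08AlphaEq324RowClassSocketEnd
import Summits.QuantumFields.YangMills.Theorems.BalabanUVNodesN08AlphaEq324RowClassSocketEndAllSteps
import Summits.QuantumFields.YangMills.Theorems.BalabanUVNodesN08AlphaEq324RowClassSocketEndUnitRange

/-!
# Route «BalabanUVNodes», Track-A DAG node N08 = [Balaban1985UV3] Thm 1 p. 257 ∕ Thm 2 p. 272 — THE CLASS-SOCKET END THEOREMS ARE INHABITED:
# the ≈25-row binder lists of parts 5∕6∕7 (`…ClassSocketEnd` η₀-route · `…EndAllSteps` b-route · `…EndUnitRange` η-route) are JOINTLY SATISFIABLE at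
# every lattice approximation, every record, every run step, and the scalar inequalities the member rows FORCE (A6 certificate of the socket ENDs)

Cell `pub-ymgap`, seat `pub-ymgap-dag-n08-w4` gen 6 (CLAIM-1 ∕ INTENT-1, INBOX l.40119).  `bears_on: R4∕N08`; filed `--supports stmt-QuantumFields-27364` (K1⁹,
helper).  THEOREMS ONLY (def-free, sorry-free, standard axioms); the three END theorems p638143 · p641004 · p642420 consumed BY NAME.

WHY.  Parts 5–7 of this seat's class socket close the (3.24) row `h324` of the edited (α) clauses from an a.e. presentation of [Balaban1985UV3]'s step block
`dμ_{C^{(k)}}(Ω_{k+1}, U_{k+1}), χ_k, 𝒱_k` by the Gaussian field of a class member (OUR class form of [BenfattoEtAl1978]'s Lemma over [Balaban1985BackgroundPropagators]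
Sect. E).  Each END carries a long binder list over `StepSeries`-typed tower data — member rows (`hK`, `Λ ≠ ∅`, symmetry, `γ_A`-coercivity, Sect.-E decay ∕ the rows
`J_c, M, M₂`), a.e.-presentation rows (`Φ` measurable, `(𝔖 k).μ = 𝒩(0,K).map Φ`, box and potential measurable, `Φ⁻¹'box =ᵐ smallFieldSet I (p(g_k))`,
`𝒱 ∘ Φ =ᵐ H_J`), instance rows (`∅ ≠ I ⊇ J`, `J ⊆ Λ`, `sup|coeff| ≤ c₀ g_k^σ`, `|I| ≤ v·|T₁^{(k)}|`) and the budget `C·v ≤ Ca + Cc` — and was filed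
hypothesis-form, with NO inhabitant of its antecedent anywhere in the tree (the class road's unconditional instances `eq324_torusFreeField` ∕ the box
fluctuation covariance live Literature-side and never meet a `StepSeries`).  The cell's A6 rule (№189) asks for exactly that inhabitant.  This module gives it,
for all three ENDs, at the ONE-SITE MEMBER (`Λ₁ = {0} ⊂ ℤ^d`, `A₁ = γ_A·1`, covariance `γ_A⁻¹·δ₀₀`) presenting the ONE-SITE DATUM (fluctuation space `ℝ^{ℤ^d}`, law
`𝒩(0, γ_A⁻¹δ₀₀)`, box `Πχ̂_{{0}, p(g_k)}`, potential `H_{{0}}` with `sup|coeff| ≤ c₀ g_k^σ`, every other field of the carrier zero) by the identity map — and records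
which scalar inequalities ANY member on a nonempty window must satisfy (so the certificates are sharp in the scalars).
* §1 ★ `gammaA_le_KA_of_member` — coercivity + Sect.-E decay on a nonempty window force `γ_A ≤ K_A` (`le_diag_of_coercive`: `γ_A ≤ A e e`; `diag_le_of_decay`:
  `A e e ≤ K_A`); ★ `gammaA_le_M_of_rowM` ∕ `gammaA_le_M₂_of_rowM₂` — the b-route rows force `γ_A ≤ M`, `γ_A ≤ M₂` (so n08-c's `max M γ_A`, `max M₂ γ_A` inside
  `B*_noPad` lose nothing).
* §2 the one-site member: `oneSite_symm ∕ _coercive ∕ _decay ∕ _rowJc ∕ _rowM ∕ _rowM₂ ∕ _inv ∕ _kernel` — every member row of all three currencies, the decay row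
  exactly when `γ_A ≤ K_A`, the `M`∕`M₂` rows reading `γ_A`, the zero-extended covariance `γ_A⁻¹·δ₀₀` in the ENDs' `hK` letter.
* §3 `one_le_sites` (`1 ≤ |T₁^{(k)}|` for `k ≤ K`); ★ `exists_stepSeries_of_blocks` — the `Carriers.StepSeries` carrier ACCEPTS ANY FAMILY OF BLOCKS `(X, μ_k, box_k, V_k)`,
  exactly presented by a measurable isomorphism: the presentation rows constrain nothing but the block.
* §4 ★★ `eq324_oneSiteDatum_allSteps_eta` (p642420 FIRES: `∃ b₁ ∀ b₀ > b₁ ∃ C ≥ 0 ∀ S ∀ k ≤ K`, budget `C ≤ Ca + Cc` ⟹ (3.24) in [B10] currencies for the one-site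
  datum, every `H_{{0}}` with `sup|coeff| ≤ c₀ g_k^σ`) · ★★ `eq324_oneSiteDatum_allSteps_b` (p641004 FIRES under its explicit window, `γ_A ≥ 2`, `M, M₂ ≥ γ_A`, `J_c ≥ 0`)
  · ★ `eq324_oneSiteDatum_eta₀` (p638143 FIRES on `g_k ≤ η₀`).  Each proof is ONE application of the END with all binder rows discharged in the kernel
  (`Measure.map_id`, `EventuallyEq.rfl`, §2, §3) — the certificate.
HONEST SCOPE.  Count-neutral A6 ∕ satisfiability bookkeeping about OUR END theorems; the one-site datum is a TOY (one Gaussian variable, an `O(g_k^σ)` polynomial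
potential) — it certifies the binders, it is NOT [Balaban1985UV3]'s fluctuation block and NOT the IDENT (NODE 00 objects ∕ class II; NOT commissioned, NOT claimed); the
budget proviso `C ≤ Ca + Cc` and the windows (`b₁ < b₀`, `B*_noPad < b₀`, `g_k ≤ η₀`) stay displayed; nothing of [Balaban1985UV3] ∕ [BenfattoEtAl1978] ∕
[Balaban1985BackgroundPropagators] asserted or discharged; `PrintedUV3V` NOT proved; N08 NOT discharged; one finite 𝕋⁴ programme at fixed ε — R4 closes the
conditional finite-𝕋⁴ rung `BalabanLadder.UV` only; nothing continuum ∕ ℝ⁴ ∕ OS ∕ mass gap ∕ Clay.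
-/

noncomputable section

namespace Summit.QuantumFields.YangMills.Theorems.BalabanUVNodesN08AlphaEq324RowClassSocketEndInhabited

open MeasureTheory
open scoped BigOperators Nat
open Literature.MathematicalPhysics.QuantumFieldTheory (gaussianFieldOfKernel)
open Literature.MathematicalPhysics.QuantumFieldTheory.Balaban1983to89
open Literature.MathematicalPhysics.QuantumFieldTheory.Balaban1983to89.B1Sect3Statements (Eq324)
open Literature.MathematicalPhysics.QuantumFieldTheory.Balaban1983to89.B1Eq324BenfattoLemma (Coef hamiltonian coefSup smallFieldSet measurableSet_smallFieldSet)
open Literature.MathematicalPhysics.QuantumFieldTheory.Balaban1983to89.B1Eq324BenfattoSect5Eq515 (measurable_hamiltonian)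
open Literature.MathematicalPhysics.QuantumFieldTheory.Balaban1983to89.TreeLengthTorus (tsys)
open Literature.MathematicalPhysics.QuantumFieldTheory.Balaban1985CMP102.Setting
open Literature.MathematicalPhysics.QuantumFieldTheory.Balaban1985CMP102.Binders (GraphTerms)
open Summit.QuantumFields.Balaban3D.Carriers
open Summit.QuantumFields.Balaban3D.Proofs.ScalesArithmetic (sites_eq_card card_site_eq one_lt_L)
open Summit.QuantumFields.Balaban3D.Proofs.Primitives (AlphaConsts)
open Summit.QuantumFields.Balaban3D.Proofs.GroupModelLieC (lieC)
open Summit.QuantumFields.YangMills.Theorems.BalabanUVNodesN08AlphaEq324RowClassSocketEnd (exists_h324Row_freeLetter_of_expDecayPresentation_ae)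
open Summit.QuantumFields.YangMills.Theorems.BalabanUVNodesN08AlphaEq324RowClassSocketEndAllSteps (exists_h324Row_freeLetter_of_kernelNoPad_allSteps_ae)
open Summit.QuantumFields.YangMills.Theorems.BalabanUVNodesN08AlphaEq324RowClassSocketEndUnitRange
  (exists_threshold_h324Row_freeLetter_of_expDecayPresentation_allSteps_ae)
open Literature.Probability.LatticeModels (cumulantOf)

variable {d : ℕ}

/-! ## §1 What the member rows FORCE on any nonempty window -/

section AnyMember

variable {Λ : Finset (Fin d → ℤ)} {A : Matrix ↥Λ ↥Λ ℝ} {γA KA κA θ M M₂ : ℝ}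

/-- Coercivity tested at a basis vector: `γ_A ≤ A e e` for every site `e` of the window. [folklore] -/
theorem le_diag_of_coercive (hco : ∀ x : ↥Λ → ℝ, γA * ∑ e, x e ^ 2 ≤ ∑ e, ∑ e', A e e' * x e * x e') (e : ↥Λ) : γA ≤ A e e := by
  classical
  have h := hco (Pi.single e 1)
  have hl : ∑ e₁ : ↥Λ, (Pi.single e (1 : ℝ) : ↥Λ → ℝ) e₁ ^ 2 = 1 := by
    rw [Finset.sum_eq_single e (fun e₁ _ hne => by simp [hne]) (fun h => (h (Finset.mem_univ _)).elim)]
    simp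
  have hr : ∑ e₁ : ↥Λ, ∑ e₂ : ↥Λ, A e₁ e₂ * (Pi.single e (1 : ℝ) : ↥Λ → ℝ) e₁ * (Pi.single e (1 : ℝ) : ↥Λ → ℝ) e₂ = A e e := by
    rw [Finset.sum_eq_single e (fun e₁ _ hne => by simp [hne]) (fun h => (h (Finset.mem_univ _)).elim)]
    rw [Finset.sum_eq_single e (fun e₂ _ hne => by simp [hne]) (fun h => (h (Finset.mem_univ _)).elim)]
    simp
  rw [hl, hr, mul_one] at h
  exact h

/-- The Sect.-E decay row on the diagonal: `A e e ≤ K_A`. [folklore] -/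
theorem diag_le_of_decay
    (hdec : ∀ e e' : ↥Λ, |A e e'| ≤ KA * Real.exp (-(κA * Real.sqrt (∑ j, ((((e : Fin d → ℤ) j : ℝ) - ((e' : Fin d → ℤ) j : ℝ))) ^ 2))))
    (e : ↥Λ) : A e e ≤ KA := by
  have h := hdec e e
  simp only [sub_self, ne_eq, OfNat.ofNat_ne_zero, not_false_eq_true, zero_pow, Finset.sum_const_zero, Real.sqrt_zero,
    mul_zero, neg_zero, Real.exp_zero, mul_one] at h
  exact (le_abs_self _).trans h

/-- ★ **The Sect.-E triple of ANY member on a nonempty window satisfies `γ_A ≤ K_A`** — the η₀-∕η-route ENDs (p638143 ∕ p642420) at scalars with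
`K_A < γ_A` are vacuous, and §4 shows they are inhabited as soon as `γ_A ≤ K_A`. [folklore] -/
theorem gammaA_le_KA_of_member (hΛ : Λ.Nonempty) (hco : ∀ x : ↥Λ → ℝ, γA * ∑ e, x e ^ 2 ≤ ∑ e, ∑ e', A e e' * x e * x e')
    (hdec : ∀ e e' : ↥Λ, |A e e'| ≤ KA * Real.exp (-(κA * Real.sqrt (∑ j, ((((e : Fin d → ℤ) j : ℝ) - ((e' : Fin d → ℤ) j : ℝ))) ^ 2)))) :
    γA ≤ KA := by
  obtain ⟨x, hx⟩ := hΛ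
  exact (le_diag_of_coercive hco ⟨x, hx⟩).trans (diag_le_of_decay hdec ⟨x, hx⟩)

/-- ★ **The b-route row `M` forces `γ_A ≤ M`** (`…EndAllSteps` p641004's member currency; n08-c's `max M γ_A` in `B*_noPad` is therefore no loss). [folklore] -/
theorem gammaA_le_M_of_rowM (hΛ : Λ.Nonempty) (hco : ∀ x : ↥Λ → ℝ, γA * ∑ e, x e ^ 2 ≤ ∑ e, ∑ e', A e e' * x e * x e')
    (hM : ∀ e : ↥Λ, ∑ e' : ↥Λ, |A e e'| * (1 + Real.sqrt (∑ j, ((((e : Fin d → ℤ) j : ℝ) - ((e' : Fin d → ℤ) j : ℝ))) ^ 2)) ≤ M) :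
    γA ≤ M := by
  obtain ⟨x, hx⟩ := hΛ
  set e : ↥Λ := ⟨x, hx⟩
  have h1 : γA ≤ |A e e| := (le_diag_of_coercive hco e).trans (le_abs_self _)
  have h2 : |A e e| * (1 + Real.sqrt (∑ j, ((((e : Fin d → ℤ) j : ℝ) - ((e : Fin d → ℤ) j : ℝ))) ^ 2)) = |A e e| := by simp
  have h3 : |A e e| * (1 + Real.sqrt (∑ j, ((((e : Fin d → ℤ) j : ℝ) - ((e : Fin d → ℤ) j : ℝ))) ^ 2)) ≤
      ∑ e' : ↥Λ, |A e e'| * (1 + Real.sqrt (∑ j, ((((e : Fin d → ℤ) j : ℝ) - ((e' : Fin d → ℤ) j : ℝ))) ^ 2)) :=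
    Finset.single_le_sum (f := fun e' : ↥Λ => |A e e'| * (1 + Real.sqrt (∑ j, ((((e : Fin d → ℤ) j : ℝ) - ((e' : Fin d → ℤ) j : ℝ))) ^ 2)))
      (fun e' _ => by positivity) (Finset.mem_univ e)
  linarith [hM e]

/-- ★ **The b-route row `M₂` forces `γ_A ≤ M₂`** (n08-c's `max M₂ γ_A` in `B*_noPad` is no loss). [folklore] -/
theorem gammaA_le_M₂_of_rowM₂ (hΛ : Λ.Nonempty) (hco : ∀ x : ↥Λ → ℝ, γA * ∑ e, x e ^ 2 ≤ ∑ e, ∑ e', A e e' * x e * x e')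
    (hM₂ : ∀ e : ↥Λ, ∑ e' : ↥Λ, |A e e'| * Real.exp (θ / 2 * Real.sqrt (∑ j, ((((e : Fin d → ℤ) j : ℝ) - ((e' : Fin d → ℤ) j : ℝ))) ^ 2)) ≤ M₂) :
    γA ≤ M₂ := by
  obtain ⟨x, hx⟩ := hΛ
  set e : ↥Λ := ⟨x, hx⟩
  have h1 : γA ≤ |A e e| := (le_diag_of_coercive hco e).trans (le_abs_self _)
  have h2 : |A e e| * Real.exp (θ / 2 * Real.sqrt (∑ j, ((((e : Fin d → ℤ) j : ℝ) - ((e : Fin d → ℤ) j : ℝ))) ^ 2)) = |A e e| := by simp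
  have h3 : |A e e| * Real.exp (θ / 2 * Real.sqrt (∑ j, ((((e : Fin d → ℤ) j : ℝ) - ((e : Fin d → ℤ) j : ℝ))) ^ 2)) ≤
      ∑ e' : ↥Λ, |A e e'| * Real.exp (θ / 2 * Real.sqrt (∑ j, ((((e : Fin d → ℤ) j : ℝ) - ((e' : Fin d → ℤ) j : ℝ))) ^ 2)) :=
    Finset.single_le_sum (f := fun e' : ↥Λ => |A e e'| * Real.exp (θ / 2 * Real.sqrt (∑ j, ((((e : Fin d → ℤ) j : ℝ) - ((e' : Fin d → ℤ) j : ℝ))) ^ 2)))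
      (fun e' _ => by positivity) (Finset.mem_univ e)
  linarith [hM₂ e]

end AnyMember

/-! ## §2 The one-site member `Λ₁ = {0}`, `A₁ = γ·1` -/

section OneSite

variable (d)

/-- All points of the one-site window coincide. [folklore] -/
theorem oneSite_eq (e e' : ↥({0} : Finset (Fin d → ℤ))) : e = e' :=
  Subtype.ext ((Finset.mem_singleton.1 e.2).trans (Finset.mem_singleton.1 e'.2).symm)

/-- Euclidean distances on the one-site window vanish. [folklore] -/
theorem oneSite_dist (e e' : ↥({0} : Finset (Fin d → ℤ))) :
    Real.sqrt (∑ j, ((((e : Fin d → ℤ) j : ℝ) - ((e' : Fin d → ℤ) j : ℝ))) ^ 2) = 0 := by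
  rw [oneSite_eq d e e']; simp

/-- A sum over the one-site window is the value at any of its points. [folklore] -/
theorem oneSite_sum (f : ↥({0} : Finset (Fin d → ℤ)) → ℝ) (e : ↥({0} : Finset (Fin d → ℤ))) : ∑ e', f e' = f e := by
  haveI : Unique ↥({0} : Finset (Fin d → ℤ)) := ⟨⟨⟨0, Finset.mem_singleton_self 0⟩⟩, fun e' => oneSite_eq d e' _⟩
  rw [Fintype.sum_unique, oneSite_eq d default e]

variable {d} (γ : ℝ)

/-- Entries of `γ·1` on the one-site window all read `γ`. [folklore] -/
theorem oneSite_apply (e e' : ↥({0} : Finset (Fin d → ℤ))) :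
    (γ • (1 : Matrix ↥({0} : Finset (Fin d → ℤ)) ↥({0} : Finset (Fin d → ℤ)) ℝ)) e e' = γ := by
  rw [oneSite_eq d e e', Matrix.smul_apply, Matrix.one_apply_eq, smul_eq_mul, mul_one]

/-- Member row: `A₁` is symmetric. [folklore] -/
theorem oneSite_symm (e e' : ↥({0} : Finset (Fin d → ℤ))) :
    (γ • (1 : Matrix ↥({0} : Finset (Fin d → ℤ)) ↥({0} : Finset (Fin d → ℤ)) ℝ)) e e' =
      (γ • (1 : Matrix ↥({0} : Finset (Fin d → ℤ)) ↥({0} : Finset (Fin d → ℤ)) ℝ)) e' e := by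
  rw [oneSite_apply, oneSite_apply]

/-- Member row: `A₁` is `γ`-coercive in the class shape `γ Σ x_e² ≤ ΣΣ A e e' x_e x_{e'}` (with equality). [folklore] -/
theorem oneSite_coercive (x : ↥({0} : Finset (Fin d → ℤ)) → ℝ) :
    γ * ∑ e, x e ^ 2 ≤ ∑ e, ∑ e', (γ • (1 : Matrix ↥({0} : Finset (Fin d → ℤ)) ↥({0} : Finset (Fin d → ℤ)) ℝ)) e e' * x e * x e' := by
  set e₀ : ↥({0} : Finset (Fin d → ℤ)) := ⟨0, Finset.mem_singleton_self 0⟩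
  rw [oneSite_sum d _ e₀, oneSite_sum d _ e₀, oneSite_sum d _ e₀, oneSite_apply]
  nlinarith

/-- Member row (Sect. E currency): `|A₁ e e'| ≤ K_A e^{−κ_A|e−e'|₂}` as soon as `|γ| ≤ K_A` (§1: `γ ≤ K_A` is also necessary). [folklore] -/
theorem oneSite_decay {KA : ℝ} (hγ : |γ| ≤ KA) (κA : ℝ) (e e' : ↥({0} : Finset (Fin d → ℤ))) :
    |(γ • (1 : Matrix ↥({0} : Finset (Fin d → ℤ)) ↥({0} : Finset (Fin d → ℤ)) ℝ)) e e'| ≤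
      KA * Real.exp (-(κA * Real.sqrt (∑ j, ((((e : Fin d → ℤ) j : ℝ) - ((e' : Fin d → ℤ) j : ℝ))) ^ 2))) := by
  rw [oneSite_apply, oneSite_dist]; simpa using hγ

/-- Member row (b-route currency): the `J_c` row of `A₁` VANISHES (`cosh 0 − 1 = 0`). [folklore] -/
theorem oneSite_rowJc (θ : ℝ) (e : ↥({0} : Finset (Fin d → ℤ))) :
    ∑ e' : ↥({0} : Finset (Fin d → ℤ)), |(γ • (1 : Matrix ↥({0} : Finset (Fin d → ℤ)) ↥({0} : Finset (Fin d → ℤ)) ℝ)) e e'| *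
      (Real.cosh (θ * Real.sqrt (∑ j, ((((e : Fin d → ℤ) j : ℝ) - ((e' : Fin d → ℤ) j : ℝ))) ^ 2)) - 1) = 0 := by
  rw [oneSite_sum d _ e, oneSite_dist]; simp

/-- Member row (b-route currency): the `M` row of `A₁` reads `|γ|`. [folklore] -/
theorem oneSite_rowM (e : ↥({0} : Finset (Fin d → ℤ))) :
    ∑ e' : ↥({0} : Finset (Fin d → ℤ)), |(γ • (1 : Matrix ↥({0} : Finset (Fin d → ℤ)) ↥({0} : Finset (Fin d → ℤ)) ℝ)) e e'| *
      (1 + Real.sqrt (∑ j, ((((e : Fin d → ℤ) j : ℝ) - ((e' : Fin d → ℤ) j : ℝ))) ^ 2)) = |γ| := by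
  rw [oneSite_sum d _ e, oneSite_dist, oneSite_apply]; simp

/-- Member row (b-route currency): the `M₂` row of `A₁` reads `|γ|`. [folklore] -/
theorem oneSite_rowM₂ (θ : ℝ) (e : ↥({0} : Finset (Fin d → ℤ))) :
    ∑ e' : ↥({0} : Finset (Fin d → ℤ)), |(γ • (1 : Matrix ↥({0} : Finset (Fin d → ℤ)) ↥({0} : Finset (Fin d → ℤ)) ℝ)) e e'| *
      Real.exp (θ / 2 * Real.sqrt (∑ j, ((((e : Fin d → ℤ) j : ℝ) - ((e' : Fin d → ℤ) j : ℝ))) ^ 2)) = |γ| := by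
  rw [oneSite_sum d _ e, oneSite_dist, oneSite_apply]; simp

/-- The inverse of the one-site member: `(γ·1)⁻¹ = γ⁻¹·1` (`γ ≠ 0`). [folklore] -/
theorem oneSite_inv (hγ : γ ≠ 0) :
    (γ • (1 : Matrix ↥({0} : Finset (Fin d → ℤ)) ↥({0} : Finset (Fin d → ℤ)) ℝ))⁻¹ =
      γ⁻¹ • (1 : Matrix ↥({0} : Finset (Fin d → ℤ)) ↥({0} : Finset (Fin d → ℤ)) ℝ) := by
  apply Matrix.inv_eq_left_inv
  rw [Matrix.smul_mul, Matrix.mul_smul, Matrix.one_mul, smul_smul, inv_mul_cancel₀ hγ, one_smul]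

/-- **The zero-extended covariance of the one-site member is `γ⁻¹·δ₀₀`**, written in the ENDs' `hK` letter
(`K x y = if x, y ∈ Λ then (A⁻¹)_{xy} else 0`). [folklore] -/
theorem oneSite_kernel (hγ : γ ≠ 0) (x y : Fin d → ℤ) :
    (if x = 0 ∧ y = 0 then γ⁻¹ else 0 : ℝ) =
      if hxy : x ∈ ({0} : Finset (Fin d → ℤ)) ∧ y ∈ ({0} : Finset (Fin d → ℤ)) then
        ((γ • (1 : Matrix ↥({0} : Finset (Fin d → ℤ)) ↥({0} : Finset (Fin d → ℤ)) ℝ))⁻¹) ⟨x, hxy.1⟩ ⟨y, hxy.2⟩ else 0 := by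
  by_cases hxy : x ∈ ({0} : Finset (Fin d → ℤ)) ∧ y ∈ ({0} : Finset (Fin d → ℤ))
  · rw [dif_pos hxy, if_pos ⟨Finset.mem_singleton.1 hxy.1, Finset.mem_singleton.1 hxy.2⟩, oneSite_inv γ hγ, oneSite_apply]
  · rw [dif_neg hxy, if_neg (fun h => hxy ⟨Finset.mem_singleton.2 h.1, Finset.mem_singleton.2 h.2⟩)]

end OneSite

/-! ## §3 Sites on the run; the carrier accepts any block -/

/-- `1 ≤ |T₁^{(k)}|` for every run step `k ≤ K` (`|T₁^{(k)}| = (2L^{m+K−k})³`). [cite: Balaban1985UV3, (5) p.256] -/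
theorem one_le_sites {L : ℕ} (S : Scales L) (k : ℕ) (hk : k ≤ S.K) : (1 : ℝ) ≤ S.sites k := by
  rw [sites_eq_card S k (le_trans hk (Nat.le_add_left _ _)), card_site_eq]
  have hL : (1 : ℝ) ≤ L := (one_lt_L S).le
  have h1 : (1 : ℝ) ≤ 2 * (L : ℝ) ^ (S.m + S.K - k) := by
    have := one_le_pow₀ (M₀ := ℝ) hL (n := S.m + S.K - k)
    linarith
  exact one_le_pow₀ h1

variable {L : ℕ} {G : Type} [GaugeGroup G] [MeasurableSpace G] [HaarData G] (𝔊 : GroupModel G) (𝔠 : AlphaConsts L 𝔊.N)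

/-- ★ **THE `StepSeries` CARRIER ACCEPTS ANY FAMILY OF BLOCKS, EXACTLY PRESENTED.**  For every measurable space `X` and every family of laws `μ_k`, boxes
`box_k h` and potentials `V_k h U` on it there is tower data `𝔖` (at the lane's chart space `𝔤ᶜ` and block counts `nblkOf`) whose `k`-th fluctuation block is
presented by a measurable isomorphism `Φ : X → (𝔖 k).Fl`: `(𝔖 k).μ = μ_k.map Φ`, `Φ⁻¹'(𝔖 k).box h = box_k h`, `(𝔖 k).𝒱 h U ∘ Φ = V_k h U` — the presentation
rows of the socket ENDs constrain the block and nothing else (every other field of the carrier is free data, here zero ∕ empty). [folklore] -/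
theorem exists_stepSeries_of_blocks (S : Scales L) (X : Type) [MeasurableSpace X] (μ : ℕ → Measure X)
    (box : ∀ k, Hist S.P (k + 1) → Set X) (V : ∀ k, Hist S.P (k + 1) → GaugeField S.P (k + 1) G → X → ℝ) :
    ∃ 𝔖 : ∀ k, StepSeries S G ↥(lieC 𝔊) (nblkOf S 𝔠.lane.carrier k) k,
      ∀ k, ∃ (Φ : X → (𝔖 k).Fl) (Ψ : (𝔖 k).Fl → X), Measurable Φ ∧ Measurable Ψ ∧ (∀ x, Ψ (Φ x) = x) ∧ (∀ ω, Φ (Ψ ω) = ω) ∧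
        (𝔖 k).μ = (μ k).map Φ ∧ (∀ h, Φ ⁻¹' (𝔖 k).box h = box k h) ∧ (∀ h U x, (𝔖 k).𝒱 h U (Φ x) = V k h U x) := by
  refine ⟨fun k =>
    { Ψ := fun _ _ => 0, Bcfg := fun _ _ _ => 0, far := fun _ _ _ => 0, PY := fun _ _ => 0, PYZ := fun _ _ => 0,
      Gt := fun _ => { Γ := PEmpty, supp := ∅, E := fun γ _ => γ.elim, loc := fun γ => γ.elim, nv := fun γ => γ.elim,
                       pref := fun γ => γ.elim, lines := fun γ => γ.elim },
      Ndeg := fun _ => 0, oldVal := fun _ _ _ _ _ _ => 0,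
      Fl := X, μ := μ k, box := box k, 𝒱 := V k,
      dimZ := fun _ => 0, QU := fun _ _ => 0, JU := fun _ _ => 0, Q1 := fun _ => 0, J1 := fun _ => 0, dimT := 0, QT := 0, JT := 0 }, fun k => ?_⟩
  exact ⟨id, id, measurable_id, measurable_id, fun _ => rfl, fun _ => rfl, Measure.map_id.symm, fun _ => rfl, fun _ _ _ => rfl⟩

/-! ## §4 The three ENDs FIRE at the one-site datum -/

/-- ★★ **THE η-ROUTE END (p642420) IS INHABITED.**  For class scalars `0 < γ_A ≤ K_A`, `κ_A > 0`, Hamiltonian shape `(s, D, ϰ > 0)`, `p₀ > 2∕3`, `σ > 0`, `c₀ ≥ 0`,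
`6 + 2κ₀ < σ(n̄ + 1)`: `∃ b₁, ∀ b₀ > b₁, ∃ C ≥ 0` such that at EVERY lattice approximation `S`, EVERY run step `k ≤ K`, under the budget `C ≤ Ca + Cc`, for EVERY
one-site potential `H_{{0}}` with `sup|coeff| ≤ c₀ g_k^σ`, the (3.24) row holds in [B10] currencies for the ONE-SITE DATUM: `Eq324 (∫_{Πχ̂_{{0},p(g_k)}} e^{H} d𝒩(0,γ_A⁻¹δ₀₀))
(free cumulants of H) n̄ (Ca + Cc) (Lᵏg₀²) (3 + κ₀) |T₁^{(k)}|`.  PROOF = `exists_threshold_h324Row_freeLetter_of_expDecayPresentation_allSteps_ae` applied to the tower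
data whose every block is `(ℝ^{ℤ^d}, 𝒩(0, γ_A⁻¹δ₀₀), Πχ̂_{{0}, p(g_k)}, H_{{0}})` (other fields zero), presented by `Φ := id` from the member `({0}, γ_A·1)`, with
`I = J = Λ = {0}`, `v := 1` — all binder rows discharged (§2, `Measure.map_id`, `EventuallyEq.rfl`, `one_le_sites`).
[cite: Balaban1985UV3, (5) p.256 + (58) p.270; Balaban1982Higgs1, (3.24) p.616; BenfattoEtAl1978, Lemma p.152 (class form; ours)] -/
theorem eq324_oneSiteDatum_allSteps_eta (hd : 0 < d) {γA KA κA : ℝ} (hγA0 : 0 < γA) (hγK : γA ≤ KA) (hκA : 0 < κA)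
    (s D : ℕ) {ϰ : ℝ} (hϰ : 0 < ϰ) {p₀ σ c₀ : ℝ} (hp₀ : 2 / 3 < p₀) (hσ : 0 < σ) (hc₀ : 0 ≤ c₀) (hκσ : 6 + 2 * 𝔠.κ₀ < σ * (𝔠.nbar + 1)) :
    ∃ b₁ : ℝ, ∀ b₀ : ℝ, b₁ < b₀ → ∃ C : ℝ, 0 ≤ C ∧
      ∀ (S : Scales L) (k : ℕ), k ≤ S.K → C ≤ 𝔠.Ca + 𝔠.Cc →
        ∀ a : Coef d, coefSup s D a {0} ≤ c₀ * S.gk k ^ σ →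
          Eq324 (∫ z in smallFieldSet ({0} : Finset (Fin d → ℤ)) (B10.pFun b₀ p₀ (S.gk k)), Real.exp (hamiltonian s D ϰ a {0} z)
                   ∂gaussianFieldOfKernel (fun x y : Fin d → ℤ => if x = 0 ∧ y = 0 then γA⁻¹ else (0 : ℝ)))
            (fun n => cumulantOf (fun m => ∫ z, hamiltonian s D ϰ a {0} z ^ m
                   ∂gaussianFieldOfKernel (fun x y : Fin d → ℤ => if x = 0 ∧ y = 0 then γA⁻¹ else (0 : ℝ))) n)
            𝔠.nbar (𝔠.Ca + 𝔠.Cc) ((L : ℝ) ^ k * S.g0sq) (3 + 𝔠.κ₀) (S.sites k) := by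
  obtain ⟨b₁, hb₁⟩ := exists_threshold_h324Row_freeLetter_of_expDecayPresentation_allSteps_ae 𝔊 𝔠 hd hγA0 (hγA0.le.trans hγK) hκA
    D hϰ hp₀ hσ hc₀ hκσ
  refine ⟨b₁, fun b₀ hb => ?_⟩
  obtain ⟨C, hC, hEND⟩ := hb₁ b₀ hb
  refine ⟨C, hC, fun S k hk hCle a ha => ?_⟩
  -- the one-site datum: every block `(ℝ^{ℤ^d}, 𝒩(0, γ_A⁻¹δ₀₀), Πχ̂_{{0}, p(g_k)}, H_{{0}})`, every other field of the carrier zero ∕ empty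
  let 𝔖₁ : ∀ k', StepSeries S G ↥(lieC 𝔊) (nblkOf S 𝔠.lane.carrier k') k' := fun k' =>
    { Ψ := fun _ _ => 0, Bcfg := fun _ _ _ => 0, far := fun _ _ _ => 0, PY := fun _ _ => 0, PYZ := fun _ _ => 0,
      Gt := fun _ => { Γ := PEmpty, supp := ∅, E := fun γ _ => γ.elim, loc := fun γ => γ.elim, nv := fun γ => γ.elim,
                       pref := fun γ => γ.elim, lines := fun γ => γ.elim },
      Ndeg := fun _ => 0, oldVal := fun _ _ _ _ _ _ => 0,
      Fl := (Fin d → ℤ) → ℝ, μ := gaussianFieldOfKernel (fun x y : Fin d → ℤ => if x = 0 ∧ y = 0 then γA⁻¹ else (0 : ℝ)),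
      box := fun _ => smallFieldSet ({0} : Finset (Fin d → ℤ)) (B10.pFun b₀ p₀ (S.gk k)), 𝒱 := fun _ _ => hamiltonian s D ϰ a {0},
      dimZ := fun _ => 0, QU := fun _ _ => 0, JU := fun _ _ => 0, Q1 := fun _ => 0, J1 := fun _ => 0, dimT := 0, QT := 0, JT := 0 }
  exact hEND S 𝔖₁ k hk 1 (by rw [mul_one]; exact hCle)
    (fun _ _ => ({0} : Finset (Fin d → ℤ))) (fun _ _ => γA • (1 : Matrix ↥({0} : Finset (Fin d → ℤ)) ↥({0} : Finset (Fin d → ℤ)) ℝ))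
    (fun _ _ x y => if x = 0 ∧ y = 0 then γA⁻¹ else (0 : ℝ)) (fun _ _ => id) s
    (fun _ _ => ({0} : Finset (Fin d → ℤ))) (fun _ _ => ({0} : Finset (Fin d → ℤ))) (fun _ _ => a)
    (fun _ _ x y => oneSite_kernel γA hγA0.ne' x y) (fun _ _ => Finset.singleton_nonempty 0) (fun _ _ => oneSite_symm γA)
    (fun _ _ => oneSite_coercive γA) (fun _ _ => oneSite_decay γA (by rwa [abs_of_pos hγA0]) κA)
    (fun _ _ => measurable_id) (fun _ _ => Measure.map_id.symm) (fun _ => measurableSet_smallFieldSet _ _)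
    (fun _ _ => measurable_hamiltonian _) (fun _ _ => Filter.EventuallyEq.rfl) (fun _ _ => Filter.EventuallyEq.rfl)
    (fun _ _ => Finset.singleton_nonempty 0) (fun _ _ => subset_rfl) (fun _ _ => subset_rfl) (fun _ _ => ha)
    (fun _ _ => by rw [Finset.card_singleton, Nat.cast_one, one_mul]; exact one_le_sites S k hk)
    (fun _ => ∅) (fun _ => 1)

/-- ★★ **THE b-ROUTE END (p641004) IS INHABITED** under its explicit window.  Class scalars of `eq324_kernel_noPad`'s currency with `γ_A ≥ 2`, `0 ≤ J_c < γ_A`,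
`θ > 0` and `M, M₂ ≥ γ_A` (§1: necessary), Hamiltonian shape `(s, D, ϰ > 0)`, `b₀ > 0`, `p₀ > 2∕3`, `σ > 0`, `c₀ ≥ 0`, `6 + 2κ₀ < σ(n̄ + 1)`, and the window
`B*_noPad(γ_A, J_c, θ, M, M₂, d, D) < b₀` (n08-c's formula verbatim): `∃ C ≥ 0` such that at EVERY `S`, EVERY `k ≤ K`, under `C ≤ Ca + Cc`, for EVERY `H_{{0}}` with
`sup|coeff| ≤ c₀ g_k^σ`, the (3.24) row holds in [B10] currencies for the one-site datum.  PROOF = `exists_h324Row_freeLetter_of_kernelNoPad_allSteps_ae` at the same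
datum ∕ member ∕ instance as the η-route certificate; the `J_c` row is `0 ≤ J_c`, the `M`∕`M₂` rows read `γ_A ≤ M`, `γ_A ≤ M₂` (§2).
[cite: Balaban1985UV3, (5) p.256 + (58) p.270; Balaban1982Higgs1, (3.24) p.616; BenfattoEtAl1978, Lemma p.152 + b* p.159 (class form; ours)] -/
theorem eq324_oneSiteDatum_allSteps_b (hd : 0 < d) {γA Jc θ M M₂ : ℝ} (hγA2 : 2 ≤ γA) (hJc0 : 0 ≤ Jc) (hJcγ : Jc < γA) (hθ : 0 < θ)
    (hγM : γA ≤ M) (hγM₂ : γA ≤ M₂) (s D : ℕ) {ϰ : ℝ} (hϰ : 0 < ϰ) {b₀ p₀ σ c₀ : ℝ} (hb₀ : 0 < b₀) (hp₀ : 2 / 3 < p₀)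
    (hσ : 0 < σ) (hc₀ : 0 ≤ c₀) (hκσ : 6 + 2 * 𝔠.κ₀ < σ * (𝔠.nbar + 1))
    (hbw :
      max (max (6 * 2 ^ d * ((d + 1).factorial : ℝ) * (4 / ((min 1 ((γA - Jc) / (4 * (((1 + 2 / θ) * (2 / (1 - Real.exp (-(θ / 2 / Real.sqrt d))) * Real.exp (θ / 2 / Real.sqrt d)) ^ d) * max M γA + max M₂ γA * ((1 + 8 / θ) * (2 / (1 - Real.exp (-(θ / 8 / Real.sqrt d))) * Real.exp (θ / 8 / Real.sqrt d)) ^ d)) + 1))) ^ d) ^ 2) ^ (d + 1)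
      + 10 * (d + 1) * ((⌈1 / (2 * θ) + Real.sqrt (Jc / γA) / θ⌉₊ + 1 : ℕ) : ℝ)
      + 2 / ((min 1 ((γA - Jc) / (4 * (((1 + 2 / θ) * (2 / (1 - Real.exp (-(θ / 2 / Real.sqrt d))) * Real.exp (θ / 2 / Real.sqrt d)) ^ d) * max M γA + max M₂ γA * ((1 + 8 / θ) * (2 / (1 - Real.exp (-(θ / 8 / Real.sqrt d))) * Real.exp (θ / 8 / Real.sqrt d)) ^ d)) + 1))) ^ (d + 1) * Real.sqrt γA)
      + ((min 1 ((γA - Jc) / (4 * (((1 + 2 / θ) * (2 / (1 - Real.exp (-(θ / 2 / Real.sqrt d))) * Real.exp (θ / 2 / Real.sqrt d)) ^ d) * max M γA + max M₂ γA * ((1 + 8 / θ) * (2 / (1 - Real.exp (-(θ / 8 / Real.sqrt d))) * Real.exp (θ / 8 / Real.sqrt d)) ^ d)) + 1))) ^ (d + 1))⁻¹ + 1)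
      (16 * (max M₂ γA * ((1 + 8 / θ) * (2 / (1 - Real.exp (-(θ / 8 / Real.sqrt d))) * Real.exp (θ / 8 / Real.sqrt d)) ^ d)) / (θ * (γA - Jc)) + 1))
      (max (2 / Real.sqrt γA) ((2 * ((D : ℝ) + 2 * d) / γA) ^ 2))
      < b₀) :
    ∃ C : ℝ, 0 ≤ C ∧
      ∀ (S : Scales L) (k : ℕ), k ≤ S.K → C ≤ 𝔠.Ca + 𝔠.Cc →
        ∀ a : Coef d, coefSup s D a {0} ≤ c₀ * S.gk k ^ σ →
          Eq324 (∫ z in smallFieldSet ({0} : Finset (Fin d → ℤ)) (B10.pFun b₀ p₀ (S.gk k)), Real.exp (hamiltonian s D ϰ a {0} z)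
                   ∂gaussianFieldOfKernel (fun x y : Fin d → ℤ => if x = 0 ∧ y = 0 then γA⁻¹ else (0 : ℝ)))
            (fun n => cumulantOf (fun m => ∫ z, hamiltonian s D ϰ a {0} z ^ m
                   ∂gaussianFieldOfKernel (fun x y : Fin d → ℤ => if x = 0 ∧ y = 0 then γA⁻¹ else (0 : ℝ))) n)
            𝔠.nbar (𝔠.Ca + 𝔠.Cc) ((L : ℝ) ^ k * S.g0sq) (3 + 𝔠.κ₀) (S.sites k) := by
  have hγA0 : 0 < γA := by linarith
  obtain ⟨C, hC, hEND⟩ := exists_h324Row_freeLetter_of_kernelNoPad_allSteps_ae 𝔊 𝔠 hd hγA2 hJc0 hJcγ hθ (by linarith) (by linarith)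
    D hϰ hb₀ hp₀ hσ hc₀ hκσ hbw
  refine ⟨C, hC, fun S k hk hCle a ha => ?_⟩
  let 𝔖₁ : ∀ k', StepSeries S G ↥(lieC 𝔊) (nblkOf S 𝔠.lane.carrier k') k' := fun k' =>
    { Ψ := fun _ _ => 0, Bcfg := fun _ _ _ => 0, far := fun _ _ _ => 0, PY := fun _ _ => 0, PYZ := fun _ _ => 0,
      Gt := fun _ => { Γ := PEmpty, supp := ∅, E := fun γ _ => γ.elim, loc := fun γ => γ.elim, nv := fun γ => γ.elim,
                       pref := fun γ => γ.elim, lines := fun γ => γ.elim },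
      Ndeg := fun _ => 0, oldVal := fun _ _ _ _ _ _ => 0,
      Fl := (Fin d → ℤ) → ℝ, μ := gaussianFieldOfKernel (fun x y : Fin d → ℤ => if x = 0 ∧ y = 0 then γA⁻¹ else (0 : ℝ)),
      box := fun _ => smallFieldSet ({0} : Finset (Fin d → ℤ)) (B10.pFun b₀ p₀ (S.gk k)), 𝒱 := fun _ _ => hamiltonian s D ϰ a {0},
      dimZ := fun _ => 0, QU := fun _ _ => 0, JU := fun _ _ => 0, Q1 := fun _ => 0, J1 := fun _ => 0, dimT := 0, QT := 0, JT := 0 }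
  exact hEND S 𝔖₁ k hk 1 (by rw [mul_one]; exact hCle)
    (fun _ _ => ({0} : Finset (Fin d → ℤ))) (fun _ _ => γA • (1 : Matrix ↥({0} : Finset (Fin d → ℤ)) ↥({0} : Finset (Fin d → ℤ)) ℝ))
    (fun _ _ x y => if x = 0 ∧ y = 0 then γA⁻¹ else (0 : ℝ)) (fun _ _ => id) s
    (fun _ _ => ({0} : Finset (Fin d → ℤ))) (fun _ _ => ({0} : Finset (Fin d → ℤ))) (fun _ _ => a)
    (fun _ _ x y => oneSite_kernel γA hγA0.ne' x y) (fun _ _ => Finset.singleton_nonempty 0) (fun _ _ => oneSite_symm γA)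
    (fun _ _ => oneSite_coercive γA) (fun _ _ e => by rw [oneSite_rowJc]; exact hJc0)
    (fun _ _ e => by rw [oneSite_rowM, abs_of_pos hγA0]; exact hγM) (fun _ _ e => by rw [oneSite_rowM₂, abs_of_pos hγA0]; exact hγM₂)
    (fun _ _ => measurable_id) (fun _ _ => Measure.map_id.symm) (fun _ => measurableSet_smallFieldSet _ _)
    (fun _ _ => measurable_hamiltonian _) (fun _ _ => Filter.EventuallyEq.rfl) (fun _ _ => Filter.EventuallyEq.rfl)
    (fun _ _ => Finset.singleton_nonempty 0) (fun _ _ => subset_rfl) (fun _ _ => subset_rfl) (fun _ _ => ha)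
    (fun _ _ => by rw [Finset.card_singleton, Nat.cast_one, one_mul]; exact one_le_sites S k hk)
    (fun _ => ∅) (fun _ => 1)

/-- ★ **THE η₀-ROUTE END (p638143) IS INHABITED** on its own range `g_k ≤ η₀`: class scalars `0 < γ_A ≤ K_A`, `κ_A > 0`, Hamiltonian shape `(s, D, ϰ > 0)`, `b₀ > 0`,
`p₀ > 2∕3`, `σ > 0`, `c₀ ≥ 0`, `6 + 2κ₀ < σ(n̄ + 1)`: `∃ η₀ ∈ (0, 1], ∃ C ≥ 0` such that at EVERY `S`, EVERY run step `k ≤ K` with `g_k ≤ η₀`, under `C ≤ Ca + Cc`, for EVERY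
`H_{{0}}` with `sup|coeff| ≤ c₀ g_k^σ`, the (3.24) row holds in [B10] currencies for the one-site datum (same datum ∕ member ∕ instance as above).
[cite: Balaban1985UV3, (22)–(24) pp.261–262 + (58) p.270; Balaban1982Higgs1, (3.24) p.616; BenfattoEtAl1978, Lemma p.152 (class form; ours)] -/
theorem eq324_oneSiteDatum_eta₀ (hd : 0 < d) {γA KA κA : ℝ} (hγA0 : 0 < γA) (hγK : γA ≤ KA) (hκA : 0 < κA)
    (s D : ℕ) {ϰ : ℝ} (hϰ : 0 < ϰ) {b₀ p₀ σ c₀ : ℝ} (hb₀ : 0 < b₀) (hp₀ : 2 / 3 < p₀) (hσ : 0 < σ) (hc₀ : 0 ≤ c₀)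
    (hκσ : 6 + 2 * 𝔠.κ₀ < σ * (𝔠.nbar + 1)) :
    ∃ η₀ C : ℝ, 0 < η₀ ∧ η₀ ≤ 1 ∧ 0 ≤ C ∧
      ∀ (S : Scales L) (k : ℕ), k ≤ S.K → S.gk k ≤ η₀ → C ≤ 𝔠.Ca + 𝔠.Cc →
        ∀ a : Coef d, coefSup s D a {0} ≤ c₀ * S.gk k ^ σ →
          Eq324 (∫ z in smallFieldSet ({0} : Finset (Fin d → ℤ)) (B10.pFun b₀ p₀ (S.gk k)), Real.exp (hamiltonian s D ϰ a {0} z)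
                   ∂gaussianFieldOfKernel (fun x y : Fin d → ℤ => if x = 0 ∧ y = 0 then γA⁻¹ else (0 : ℝ)))
            (fun n => cumulantOf (fun m => ∫ z, hamiltonian s D ϰ a {0} z ^ m
                   ∂gaussianFieldOfKernel (fun x y : Fin d → ℤ => if x = 0 ∧ y = 0 then γA⁻¹ else (0 : ℝ))) n)
            𝔠.nbar (𝔠.Ca + 𝔠.Cc) ((L : ℝ) ^ k * S.g0sq) (3 + 𝔠.κ₀) (S.sites k) := by
  obtain ⟨η₀, C, hη₀, hη₀1, hC, hEND⟩ := exists_h324Row_freeLetter_of_expDecayPresentation_ae 𝔊 𝔠 hd hγA0 (hγA0.le.trans hγK) hκA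
    D hϰ hb₀ hp₀ hσ hc₀ hκσ
  refine ⟨η₀, C, hη₀, hη₀1, hC, fun S k hk hgk hCle a ha => ?_⟩
  let 𝔖₁ : ∀ k', StepSeries S G ↥(lieC 𝔊) (nblkOf S 𝔠.lane.carrier k') k' := fun k' =>
    { Ψ := fun _ _ => 0, Bcfg := fun _ _ _ => 0, far := fun _ _ _ => 0, PY := fun _ _ => 0, PYZ := fun _ _ => 0,
      Gt := fun _ => { Γ := PEmpty, supp := ∅, E := fun γ _ => γ.elim, loc := fun γ => γ.elim, nv := fun γ => γ.elim,
                       pref := fun γ => γ.elim, lines := fun γ => γ.elim },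
      Ndeg := fun _ => 0, oldVal := fun _ _ _ _ _ _ => 0,
      Fl := (Fin d → ℤ) → ℝ, μ := gaussianFieldOfKernel (fun x y : Fin d → ℤ => if x = 0 ∧ y = 0 then γA⁻¹ else (0 : ℝ)),
      box := fun _ => smallFieldSet ({0} : Finset (Fin d → ℤ)) (B10.pFun b₀ p₀ (S.gk k)), 𝒱 := fun _ _ => hamiltonian s D ϰ a {0},
      dimZ := fun _ => 0, QU := fun _ _ => 0, JU := fun _ _ => 0, Q1 := fun _ => 0, J1 := fun _ => 0, dimT := 0, QT := 0, JT := 0 }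
  exact hEND S 𝔖₁ k 1 hgk (by rw [mul_one]; exact hCle)
    (fun _ _ => ({0} : Finset (Fin d → ℤ))) (fun _ _ => γA • (1 : Matrix ↥({0} : Finset (Fin d → ℤ)) ↥({0} : Finset (Fin d → ℤ)) ℝ))
    (fun _ _ x y => if x = 0 ∧ y = 0 then γA⁻¹ else (0 : ℝ)) (fun _ _ => id) s
    (fun _ _ => ({0} : Finset (Fin d → ℤ))) (fun _ _ => ({0} : Finset (Fin d → ℤ))) (fun _ _ => a)
    (fun _ _ x y => oneSite_kernel γA hγA0.ne' x y) (fun _ _ => Finset.singleton_nonempty 0) (fun _ _ => oneSite_symm γA)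
    (fun _ _ => oneSite_coercive γA) (fun _ _ => oneSite_decay γA (by rwa [abs_of_pos hγA0]) κA)
    (fun _ _ => measurable_id) (fun _ _ => Measure.map_id.symm) (fun _ => measurableSet_smallFieldSet _ _)
    (fun _ _ => measurable_hamiltonian _) (fun _ _ => Filter.EventuallyEq.rfl) (fun _ _ => Filter.EventuallyEq.rfl)
    (fun _ _ => Finset.singleton_nonempty 0) (fun _ _ => subset_rfl) (fun _ _ => subset_rfl) (fun _ _ => ha)
    (fun _ _ => by rw [Finset.card_singleton, Nat.cast_one, one_mul]; exact one_le_sites S k hk)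
    (fun _ => ∅) (fun _ => 1)

end Summit.QuantumFields.YangMills.Theorems.BalabanUVNodesN08AlphaEq324RowClassSocketEndInhabited

end
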